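import Mathlib
import Literature.Probability.LatticeModels.GKSInequalities
import Summits.CriticalPhenomena.Ising3DConformalLimit.Theorems.PrecisionLaplacianInverseMFerromagnetEntryNonposOfPcov
import Summits.CriticalPhenomena.Ising3DConformalLimit.Theorems.PrecisionLaplacianInverseMFerromagnetRowDegLeTwo
import Summits.CriticalPhenomena.Ising3DConformalLimit.Theorems.PrecisionLaplacianInverseMFerromagnetImNonadjOfLaw2Aux
import Summits.CriticalPhenomena.Ising3DConformalLimit.Theorems.PrecisionLaplacianInverseMFerromagnetImNonadjOfLaw2Aux2
import HarnessLib

/-!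
# Crux `PrecisionLaplacian.InverseMFerromagnet` (stmt-CriticalPhenomena-4798), line `Sketch` —
# stub `helper_nim3_six_of` (`Law₂` on six sites with `x, y` free ⇒ `NIM₃(6)`)

THEOREM-ONLY file (no definitions).  This is the six-site specialisation of C2
(`stub_imNonadj_of_law2`, `…ImNonadjOfLaw2.lean`) with a LOCAL `Law₂` hypothesis: for the
second-moment matrix `Σ = (⟨σ_pσ_q⟩)` of a zero-field pair ferromagnet `μ = gksExpect univ K C`
(`K ≥ 0`, `|C i| = 2`) on `Fin 6` and non-adjacent `x ≠ y` of degree `≤ 3` we prove `(Σ⁻¹)_xy ≤ 0`,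
assuming `Law₂` (`v_Aᵀ Σ⁻¹ v_B ≤ ⟨σ_Aσ_B⟩`, `v_A(w) = ⟨σ_Aσ_w⟩`, `|A| = |B| = 3`) only for pair
ferromagnets on `Fin 6` whose bonds avoid `x, y` and for `A, B` avoiding `x, y`.

Proof.  Verbatim the proof of C2 (Callen identity `c2_integrate`, Walsh form `c2_three`, residual
calculus `c2_res_lin`/`c2_res_symm`/`c2_res_degen`, star–triangle decimation `c2_nu`, Schur step
`stub_entry_nonpos_of_pcov`, degree `≤ 2` by `stub_row_deg_le_two`), except that `Law₂` is applied
(`n6_law2_res_local`) to the decimated system `ν` after PRUNING its bonds through `x, y`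
(`n6_prune`): these carry zero coupling, so deleting them and re-indexing the remaining bonds by
`Fin m''` changes neither the Hamiltonian nor any expectation, and the pruned system is a pair
ferromagnet on `Fin 6` whose bonds avoid `x, y` — exactly the scope of the local hypothesis.
-/

namespace Summit.CriticalPhenomena.Ising3DConformalLimit.Cruxes.InverseMFerromagnet.PartialCovarianceLadder

open Literature.Probability.LatticeModels Finset Matrix

/-- **Pruning free bonds.** If every bond through `x` or `y` carries zero coupling, deleting these
bonds (and re-indexing the others by `Fin m''`) gives a pair system with the same expectations whose
bonds avoid `x, y`. [folklore] -/
theorem n6_prune {n m' : ℕ} (K' : Fin m' → ℝ) (C' : Fin m' → Finset (Fin n))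
    (hK' : ∀ i, 0 ≤ K' i) (hC' : ∀ i, (C' i).card = 2) (x y : Fin n)
    (hX : ∀ i, x ∈ C' i → K' i = 0) (hY : ∀ i, y ∈ C' i → K' i = 0) :
    ∃ (m'' : ℕ) (K'' : Fin m'' → ℝ) (C'' : Fin m'' → Finset (Fin n)), (∀ i, 0 ≤ K'' i) ∧
      (∀ i, (C'' i).card = 2) ∧ (∀ i, x ∉ C'' i) ∧ (∀ i, y ∉ C'' i) ∧
      ∀ f : SpinConfig (Fin n) → ℝ,
        gksExpect Finset.univ K'' C'' f = gksExpect Finset.univ K' C' f := by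
  obtain ⟨F, hF⟩ : ∃ F : Finset (Fin m'), F = Finset.univ.filter fun i => x ∉ C' i ∧ y ∉ C' i :=
    ⟨_, rfl⟩
  have hmem : ∀ i, i ∈ F → x ∉ C' i ∧ y ∉ C' i := fun i hi => by
    rw [hF, Finset.mem_filter] at hi
    exact hi.2
  obtain ⟨m'', ⟨e⟩⟩ := Finite.exists_equiv_fin ↥F
  refine ⟨m'', (fun i : ↥F => K' i.1) ∘ e.symm, (fun i : ↥F => C' i.1) ∘ e.symm,
    fun i => hK' _, fun i => hC' _, fun i => (hmem _ (e.symm i).2).1,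
    fun i => (hmem _ (e.symm i).2).2, fun f => ?_⟩
  rw [c2_reindex e]
  have hH : ∀ ω, gksHamiltonian Finset.univ (fun i : ↥F => K' i.1) (fun i : ↥F => C' i.1) ω
      = gksHamiltonian Finset.univ K' C' ω := fun ω => by
    unfold gksHamiltonian
    rw [Finset.sum_coe_sort F (fun i => K' i * spinProduct (C' i) ω)]
    refine Finset.sum_subset (Finset.subset_univ F) fun i _ hi => ?_
    rw [hF, Finset.mem_filter, not_and, not_and_or, not_not, not_not] at hi
    rcases hi (Finset.mem_univ i) with h | h
    · rw [hX i h, zero_mul]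
    · rw [hY i h, zero_mul]
  simp only [gksExpect, gksSum, gksWeight, hH]

/-- **Local `Law₂` for the decimated system gives a nonnegative residual** (six sites).  If
`ν = gksExpect univ K' C'` is a pair ferromagnet on `Fin 6` in which `x ≠ y` are free and which has
the same expectations as `μ = gksExpect univ K C` on observables not involving `σ_x, σ_y`, then
`Law₂` for pair ferromagnets whose bonds avoid `x, y` (applied to the pruning of `ν`, `n6_prune`)
gives, for 3-sets `A, B` avoiding `x, y`:
`⟨σ_Bσ_A⟩_μ − ∑_{p,q ∉ {x,y}} ⟨σ_Bσ_p⟩_μ ((Σ_μ)_SS)⁻¹_pq ⟨σ_Aσ_q⟩_μ ≥ 0` (cf. `c2_law2_res`). [folklore] -/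
theorem n6_law2_res_local
    (hlaw : ∀ (m : ℕ) (K : Fin m → ℝ) (C : Fin m → Finset (Fin 6)), (∀ i, 0 ≤ K i) →
      (∀ i, (C i).card = 2) → ∀ x y : Fin 6, x ≠ y → (∀ i, x ∉ C i) → (∀ i, y ∉ C i) →
        ∀ (A B : Finset (Fin 6)), A.card = 3 → B.card = 3 → x ∉ A → y ∉ A → x ∉ B → y ∉ B →
          dotProduct (fun w => gksExpect Finset.univ K C (fun ω => spinProduct A ω * spinAt w ω))
            (((Matrix.of fun p q : Fin 6 =>
                gksExpect Finset.univ K C (fun ω => spinAt p ω * spinAt q ω))⁻¹).mulVec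
              (fun w => gksExpect Finset.univ K C (fun ω => spinProduct B ω * spinAt w ω)))
          ≤ gksExpect Finset.univ K C (fun ω => spinProduct A ω * spinProduct B ω))
    {m m' : ℕ} (K : Fin m → ℝ) (C : Fin m → Finset (Fin 6)) (K' : Fin m' → ℝ)
    (C' : Fin m' → Finset (Fin 6)) (hK' : ∀ i, 0 ≤ K' i) (hC' : ∀ i, (C' i).card = 2) (x y : Fin 6)
    (hxy : x ≠ y) (hX : ∀ i, x ∈ C' i → K' i = 0) (hY : ∀ i, y ∈ C' i → K' i = 0)
    (hdec : ∀ f : SpinConfig (Fin 6) → ℝ, (∀ ω, f (ω * Pi.mulSingle x (-1)) = f ω) →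
      (∀ ω, f (ω * Pi.mulSingle y (-1)) = f ω) →
      gksExpect Finset.univ K C f = gksExpect Finset.univ K' C' f)
    (S : Finset (Fin 6)) (hS2 : ∀ p, p ∉ S → p = x ∨ p = y) (hS1 : ∀ p : ↥S, p.1 ≠ x ∧ p.1 ≠ y)
    (A B : Finset (Fin 6)) (hA : A.card = 3) (hB : B.card = 3)
    (hxA : x ∉ A) (hyA : y ∉ A) (hxB : x ∉ B) (hyB : y ∉ B) :
    0 ≤ gksExpect Finset.univ K C (fun ω => spinProduct B ω * spinProduct A ω)
      - ∑ p : ↥S, ∑ q : ↥S,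
        gksExpect Finset.univ K C (fun ω => spinProduct B ω * spinAt p.1 ω)
          * ((Matrix.of fun p q : Fin 6 =>
              gksExpect Finset.univ K C (fun ω => spinAt p ω * spinAt q ω)).submatrix
                (Subtype.val : ↥S → Fin 6) (Subtype.val : ↥S → Fin 6))⁻¹ p q
          * gksExpect Finset.univ K C (fun ω => spinProduct A ω * spinAt q.1 ω) := by
  -- `Law₂` for the pruned decimated system, rewritten back to `ν = gksExpect univ K' C'`
  obtain ⟨m'', K'', C'', hK'', hC'', hX'', hY'', hpr⟩ := n6_prune K' C' hK' hC' x y hX hY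
  have hl := hlaw m'' K'' C'' hK'' hC'' x y hxy hX'' hY'' B A hB hA hxB hyB hxA hyA
  simp only [hpr] at hl
  set N : Matrix (Fin 6) (Fin 6) ℝ :=
    Matrix.of fun p q : Fin 6 => gksExpect Finset.univ K' C' (fun ω => spinAt p ω * spinAt q ω)
    with hN
  have hNpd : N.PosDef := schur_posDef 6 m' K' C'
  have hNS : ∀ p, p ∉ S → ∀ k, k ≠ p → N p k = 0 := by
    intro p hp k hk
    rcases hS2 p hp with rfl | rfl
    · exact c2_free K' C' _ hX (spinAt k) (fun ω => pcm2im_spinAt_flip_ne hk ω)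
    · exact c2_free K' C' _ hY (spinAt k) (fun ω => pcm2im_spinAt_flip_ne hk ω)
  have hu : ∀ p, p ∉ S →
      gksExpect Finset.univ K' C' (fun ω => spinProduct A ω * spinAt p ω) = 0 := by
    intro p hp
    have h1 : (fun ω => spinProduct A ω * spinAt p ω) = fun ω => spinAt p ω * spinProduct A ω :=
      funext fun ω => mul_comm _ _
    rw [h1]
    rcases hS2 p hp with rfl | rfl
    · exact c2_free K' C' _ hX _ (c2_spinProduct_flip hxA)
    · exact c2_free K' C' _ hY _ (c2_spinProduct_flip hyA)
  rw [c2_block N hNpd S hNS _ _ hu] at hl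
  have hinv : ∀ (D : Finset (Fin 6)) (p : ↥S), x ∉ D → y ∉ D →
      gksExpect Finset.univ K C (fun ω => spinProduct D ω * spinAt p.1 ω)
        = gksExpect Finset.univ K' C' (fun ω => spinProduct D ω * spinAt p.1 ω) :=
    fun D p hxD hyD => hdec _
      (fun ω => by rw [c2_spinProduct_flip hxD, pcm2im_spinAt_flip_ne (hS1 p).1])
      (fun ω => by rw [c2_spinProduct_flip hyD, pcm2im_spinAt_flip_ne (hS1 p).2])
  have e1 : gksExpect Finset.univ K C (fun ω => spinProduct B ω * spinProduct A ω)
      = gksExpect Finset.univ K' C' (fun ω => spinProduct B ω * spinProduct A ω) :=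
    hdec _ (fun ω => by rw [c2_spinProduct_flip hxB, c2_spinProduct_flip hxA])
      (fun ω => by rw [c2_spinProduct_flip hyB, c2_spinProduct_flip hyA])
  have hsub : (Matrix.of fun p q : Fin 6 =>
      gksExpect Finset.univ K C (fun ω => spinAt p ω * spinAt q ω)).submatrix
        (Subtype.val : ↥S → Fin 6) (Subtype.val : ↥S → Fin 6)
      = N.submatrix (Subtype.val : ↥S → Fin 6) (Subtype.val : ↥S → Fin 6) := by
    ext p q
    simp only [Matrix.submatrix_apply, hN, Matrix.of_apply]
    exact hdec _
      (fun ω => by rw [pcm2im_spinAt_flip_ne (hS1 p).1, pcm2im_spinAt_flip_ne (hS1 q).1])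
      (fun ω => by rw [pcm2im_spinAt_flip_ne (hS1 p).2, pcm2im_spinAt_flip_ne (hS1 q).2])
  rw [e1, hsub]
  simp only [hinv B _ hxB hyB, hinv A _ hxA hyA]
  linarith [hl]

/-- Registered stub `helper_nim3_six_of` (line `Sketch`): on six sites, `Law₂` for pair
ferromagnets whose bonds avoid `x ≠ y` (and 3-sets `A, B` avoiding `x, y`) implies
`(Σ⁻¹)_xy ≤ 0` for non-adjacent `x ≠ y` of degree `≤ 3`.  The proof is that of C2
(`stub_imNonadj_of_law2`): `PCov(x,y|R) = Res(tanh h_x, tanh h_y) = κ_xκ_y Res(σ_{∂y}, σ_{∂x})`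
(`c2_integrate`, `c2_three`, `c2_res_lin`, `c2_res_symm`, `c2_res_degen`), the last residual being
the `Law₂` bracket of the (pruned) star–triangle decimation `ν` (`c2_nu`, `n6_law2_res_local`),
hence `≥ 0`; S1 (`stub_entry_nonpos_of_pcov`) concludes, degree `≤ 2` is C3
(`stub_row_deg_le_two`). [folklore] -/
theorem helper_nim3_six_of :
    (∀ (m : ℕ) (K : Fin m → ℝ) (C : Fin m → Finset (Fin 6)), (∀ i, 0 ≤ K i) → (∀ i, (C i).card = 2) →
      ∀ x y : Fin 6, x ≠ y → (∀ i, x ∉ C i) → (∀ i, y ∉ C i) →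
        ∀ (A B : Finset (Fin 6)), A.card = 3 → B.card = 3 → x ∉ A → y ∉ A → x ∉ B → y ∉ B →
          dotProduct (fun w => gksExpect Finset.univ K C (fun ω => spinProduct A ω * spinAt w ω))
            (((Matrix.of fun p q : Fin 6 =>
                gksExpect Finset.univ K C (fun ω => spinAt p ω * spinAt q ω))⁻¹).mulVec
              (fun w => gksExpect Finset.univ K C (fun ω => spinProduct B ω * spinAt w ω)))
          ≤ gksExpect Finset.univ K C (fun ω => spinProduct A ω * spinProduct B ω)) →
    ∀ (m : ℕ) (K : Fin m → ℝ) (C : Fin m → Finset (Fin 6)), (∀ i, 0 ≤ K i) → (∀ i, (C i).card = 2) →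
      ∀ x y : Fin 6, x ≠ y → (∀ i, ¬ (x ∈ C i ∧ y ∈ C i)) →
        (Finset.univ.filter (fun i => x ∈ C i)).card ≤ 3 → (Finset.univ.filter (fun i => y ∈ C i)).card ≤ 3 →
        (Matrix.of fun p q : Fin 6 => gksExpect Finset.univ K C (fun ω => spinAt p ω * spinAt q ω))⁻¹ x y ≤ 0 := by
  intro hlaw m K C hK hC x y hxy hnadj hdx hdy
  -- sites of degree `≤ 2`: C3
  by_cases hdx2 : (Finset.univ.filter fun i => x ∈ C i).card ≤ 2
  · exact stub_row_deg_le_two 6 m K C hK hC x y hxy hdx2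
  -- a site `d ∉ {x, y}` (a neighbour of `x`)
  obtain ⟨d, hdx', hdy'⟩ : ∃ d : Fin 6, d ≠ x ∧ d ≠ y := by
    obtain ⟨i, hi⟩ : (Finset.univ.filter fun i => x ∈ C i).Nonempty := by
      rw [← Finset.card_pos]; omega
    have hxi : x ∈ C i := (Finset.mem_filter.1 hi).2
    obtain ⟨p, hp, hpx⟩ := Finset.exists_mem_ne (s := C i) (by rw [hC i]; norm_num) x
    exact ⟨p, hpx, fun h => hnadj i ⟨hxi, h ▸ hp⟩⟩
  have hnadj' : ∀ i, ¬ (y ∈ C i ∧ x ∈ C i) := fun i h => hnadj i ⟨h.2, h.1⟩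
  -- local fields `h_x = ∑ a_j σ_{v_j}`, `h_y = ∑ b_j σ_{w_j}` and their Walsh / star–triangle forms
  obtain ⟨a, v, ha, hv, hHx⟩ := c2_site K C hK hC x y hnadj hdx d ⟨hdx', hdy'⟩
  obtain ⟨b, w, hb, hw, hHy⟩ := c2_site K C hK hC y x hnadj' hdy d ⟨hdy', hdx'⟩
  obtain ⟨α, κx, cx, Jx, hκx, hJx, h3x⟩ := c2_three a ha
  obtain ⟨β, κy, cy, Jy, hκy, hJy, h3y⟩ := c2_three b hb
  obtain ⟨hx, hhx⟩ : ∃ hx : SpinConfig (Fin 6) → ℝ, ∀ ω, hx ω = ∑ j, a j * spinAt (v j) ω :=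
    ⟨_, fun _ => rfl⟩
  obtain ⟨hy, hhy⟩ : ∃ hy : SpinConfig (Fin 6) → ℝ, ∀ ω, hy ω = ∑ j, b j * spinAt (w j) ω :=
    ⟨_, fun _ => rfl⟩
  have hH1 : ∀ ω, gksHamiltonian Finset.univ K C ω
      = gksHamiltonian Finset.univ (fun i => if x ∈ C i then 0 else K i) C ω + spinAt x ω * hx ω :=
    fun ω => by rw [hhx]; exact hHx K (fun _ _ => rfl) ω
  have hH2 : ∀ ω, gksHamiltonian Finset.univ (fun i => if x ∈ C i then 0 else K i) C ω
      = gksHamiltonian Finset.univ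
          (fun i => if y ∈ C i then 0 else if x ∈ C i then 0 else K i) C ω + spinAt y ω * hy ω :=
    fun ω => by rw [hhy]; exact hHy _ (fun i hi => if_neg fun h => hnadj i ⟨h, hi⟩) ω
  have hH2' : ∀ ω, gksHamiltonian Finset.univ K C ω
      = gksHamiltonian Finset.univ (fun i => if y ∈ C i then 0 else K i) C ω + spinAt y ω * hy ω :=
    fun ω => by rw [hhy]; exact hHy K (fun _ _ => rfl) ω
  have hvx : ∀ j, v j ≠ x := fun j => (hv j).1
  have hvy : ∀ j, v j ≠ y := fun j => (hv j).2
  have hwy : ∀ j, w j ≠ y := fun j => (hw j).1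
  have hwx : ∀ j, w j ≠ x := fun j => (hw j).2
  have hx_x : ∀ ω, hx (ω * Pi.mulSingle x (-1)) = hx ω := fun ω => by
    rw [hhx, hhx]; exact Finset.sum_congr rfl fun j _ => by rw [pcm2im_spinAt_flip_ne (hvx j)]
  have hx_y : ∀ ω, hx (ω * Pi.mulSingle y (-1)) = hx ω := fun ω => by
    rw [hhx, hhx]; exact Finset.sum_congr rfl fun j _ => by rw [pcm2im_spinAt_flip_ne (hvy j)]
  have hy_y : ∀ ω, hy (ω * Pi.mulSingle y (-1)) = hy ω := fun ω => by
    rw [hhy, hhy]; exact Finset.sum_congr rfl fun j _ => by rw [pcm2im_spinAt_flip_ne (hwy j)]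
  -- the conditional expectations `E[σ_x F] = E[tanh(h_x) F]`, `E[σ_y F] = E[tanh(h_y) F]`
  have hEx : ∀ F : SpinConfig (Fin 6) → ℝ, (∀ ω, F (ω * Pi.mulSingle x (-1)) = F ω) →
      gksExpect Finset.univ K C (fun ω => spinAt x ω * F ω)
        = gksExpect Finset.univ K C (fun ω => Real.tanh (hx ω) * F ω) :=
    fun F hF => (c2_integrate Finset.univ K _ C x hx hH1 (fun i _ hi => if_pos hi) hx_x F hF).1
  have hEy : ∀ F : SpinConfig (Fin 6) → ℝ, (∀ ω, F (ω * Pi.mulSingle y (-1)) = F ω) →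
      gksExpect Finset.univ K C (fun ω => spinAt y ω * F ω)
        = gksExpect Finset.univ K C (fun ω => Real.tanh (hy ω) * F ω) :=
    fun F hF => (c2_integrate Finset.univ K _ C y hy hH2' (fun i _ hi => if_pos hi) hy_y F hF).1
  -- the normalised weight `P` of `μ`
  obtain ⟨P, hPdef⟩ : ∃ P : SpinConfig (Fin 6) → ℝ,
      ∀ ω, P ω = gksWeight Finset.univ K C ω / gksSum Finset.univ K C (fun _ => 1) :=
    ⟨_, fun _ => rfl⟩
  have hP : ∀ f : SpinConfig (Fin 6) → ℝ, gksExpect Finset.univ K C f = ∑ ω, P ω * f ω := fun f => by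
    simp only [gksExpect, gksSum, Finset.sum_div, hPdef]
    exact Finset.sum_congr rfl fun ω _ => by ring
  -- the matrix `G = Σ`, the set `S = univ ∖ {x, y}` and the Schur step S1
  obtain ⟨G, hG⟩ : ∃ G : Matrix (Fin 6) (Fin 6) ℝ, G = Matrix.of fun p q : Fin 6 =>
      gksExpect Finset.univ K C (fun ω => spinAt p ω * spinAt q ω) := ⟨_, rfl⟩
  have hGe : ∀ p q, G p q = gksExpect Finset.univ K C (fun ω => spinAt p ω * spinAt q ω) :=
    fun p q => by rw [hG]; rfl
  rw [← hG]
  obtain ⟨S, hS⟩ : ∃ S : Finset (Fin 6), S = (Finset.univ.erase x).erase y := ⟨_, rfl⟩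
  have hS1 : ∀ p : ↥S, p.1 ≠ x ∧ p.1 ≠ y := fun p => by
    have h : p.1 ∈ (Finset.univ.erase x).erase y := by rw [← hS]; exact p.2
    rw [Finset.mem_erase, Finset.mem_erase] at h
    exact ⟨h.2.1, h.1⟩
  have hS2 : ∀ p, p ∉ S → p = x ∨ p = y := fun p hp => by
    rw [hS] at hp
    simp only [Finset.mem_erase, Finset.mem_univ, and_true, not_and, not_not] at hp
    tauto
  refine stub_entry_nonpos_of_pcov 6 m K C hK hC G hG x y S hxy hS ?_
  obtain ⟨M, hMd⟩ : ∃ M : Matrix ↥S ↥S ℝ,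
      M = G.submatrix (Subtype.val : ↥S → Fin 6) (Subtype.val : ↥S → Fin 6) := ⟨_, rfl⟩
  rw [← hMd]
  obtain ⟨χ, hχ⟩ : ∃ χ : ↥S → SpinConfig (Fin 6) → ℝ, ∀ p ω, χ p ω = spinAt p.1 ω :=
    ⟨_, fun _ _ => rfl⟩
  have hM : ∀ p q, M p q = ∑ ω, P ω * (χ p ω * χ q ω) := fun p q => by
    rw [hMd, Matrix.submatrix_apply, hGe, hP]
    simp only [hχ]
  have hdet : IsUnit M.det := by
    have hpd : M.PosDef := by
      rw [hMd, hG]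
      exact (schur_posDef 6 m K C).submatrix Subtype.val_injective
    exact (Matrix.isUnit_iff_isUnit_det M).mp hpd.isUnit
  -- `PCov(x,y|S) = Res(f_x, f_y)` with `f_x = tanh h_x`, `f_y = tanh h_y`
  obtain ⟨fx, hfx⟩ : ∃ fx : SpinConfig (Fin 6) → ℝ, ∀ ω, fx ω = Real.tanh (hx ω) :=
    ⟨_, fun _ => rfl⟩
  obtain ⟨fy, hfy⟩ : ∃ fy : SpinConfig (Fin 6) → ℝ, ∀ ω, fy ω = Real.tanh (hy ω) :=
    ⟨_, fun _ => rfl⟩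
  have hGxy : G x y = ∑ ω, P ω * (fx ω * fy ω) := by
    rw [hGe, hEx _ (fun ω => pcm2im_spinAt_flip_ne hxy.symm ω)]
    have h1 : (fun ω => Real.tanh (hx ω) * spinAt y ω) = fun ω => spinAt y ω * Real.tanh (hx ω) :=
      funext fun ω => mul_comm _ _
    rw [h1, hEy _ (fun ω => by rw [hx_y]), hP]
    exact Finset.sum_congr rfl fun ω _ => by rw [hfx, hfy]; ring
  have hGxp : ∀ p : ↥S, G x p.1 = ∑ ω, P ω * (fx ω * χ p ω) := fun p => by
    rw [hGe, hEx _ (fun ω => pcm2im_spinAt_flip_ne (hS1 p).1 ω), hP]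
    exact Finset.sum_congr rfl fun ω _ => by rw [hfx, hχ]
  have hGqy : ∀ q : ↥S, G q.1 y = ∑ ω, P ω * (fy ω * χ q ω) := fun q => by
    rw [hGe]
    have h1 : (fun ω => spinAt q.1 ω * spinAt y ω) = fun ω => spinAt y ω * spinAt q.1 ω :=
      funext fun ω => mul_comm _ _
    rw [h1, hEy _ (fun ω => pcm2im_spinAt_flip_ne (hS1 q).2 ω), hP]
    exact Finset.sum_congr rfl fun ω _ => by rw [hfy, hχ]
  rw [hGxy]
  simp only [hGxp, hGqy]
  -- the Walsh forms of `f_x`, `f_y`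
  have hvS : ∀ j, v j ∈ S := fun j => by rw [hS]; simp [hvx j, hvy j]
  have hwS : ∀ j, w j ∈ S := fun j => by rw [hS]; simp [hwx j, hwy j]
  obtain ⟨ιv, hιv⟩ : ∃ ι : Fin 3 → ↥S, ∀ j, (ι j).1 = v j := ⟨fun j => ⟨v j, hvS j⟩, fun _ => rfl⟩
  obtain ⟨ιw, hιw⟩ : ∃ ι : Fin 3 → ↥S, ∀ j, (ι j).1 = w j := ⟨fun j => ⟨w j, hwS j⟩, fun _ => rfl⟩
  have tx : ∀ ω, fx ω = ∑ j, α j * χ (ιv j) ω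
      + κx * (spinAt (v 0) ω * spinAt (v 1) ω * spinAt (v 2) ω) := fun ω => by
    rw [hfx, hhx]
    simp only [hχ, hιv]
    exact (h3x (fun j => spinAt (v j) ω) (fun j => spinAt_eq_one_or_eq_neg_one _ _)).1
  have ty : ∀ ω, fy ω = ∑ j, β j * χ (ιw j) ω
      + κy * (spinAt (w 0) ω * spinAt (w 1) ω * spinAt (w 2) ω) := fun ω => by
    rw [hfy, hhy]
    simp only [hχ, hιw]
    exact (h3y (fun j => spinAt (w j) ω) (fun j => spinAt_eq_one_or_eq_neg_one _ _)).1
  by_cases hvd : v 0 ≠ v 1 ∧ v 0 ≠ v 2 ∧ v 1 ≠ v 2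
  · obtain ⟨A, hA⟩ : ∃ A : Finset (Fin 6), A = {v 0, v 1, v 2} := ⟨_, rfl⟩
    have hA3 : A.card = 3 := by
      rw [hA, Finset.card_eq_three]
      exact ⟨_, _, _, hvd.1, hvd.2.1, hvd.2.2, rfl⟩
    have hxA : x ∉ A := hA ▸ c2_notMem_three v x hvx
    have hyA : y ∉ A := hA ▸ c2_notMem_three v y hvy
    have tx' : ∀ ω, fx ω = ∑ j, α j * χ (ιv j) ω + κx * spinProduct A ω := fun ω => by
      rw [tx, hA, c2_spinProduct_three hvd.1 hvd.2.1 hvd.2.2]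
    rw [c2_res_lin P χ M hM hdet fx (spinProduct A) fy ιv α κx tx',
      c2_res_symm P χ M hM (spinProduct A) fy]
    by_cases hwd : w 0 ≠ w 1 ∧ w 0 ≠ w 2 ∧ w 1 ≠ w 2
    · obtain ⟨B, hB⟩ : ∃ B : Finset (Fin 6), B = {w 0, w 1, w 2} := ⟨_, rfl⟩
      have hB3 : B.card = 3 := by
        rw [hB, Finset.card_eq_three]
        exact ⟨_, _, _, hwd.1, hwd.2.1, hwd.2.2, rfl⟩
      have hxB : x ∉ B := hB ▸ c2_notMem_three w x hwx
      have hyB : y ∉ B := hB ▸ c2_notMem_three w y hwy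
      have ty' : ∀ ω, fy ω = ∑ j, β j * χ (ιw j) ω + κy * spinProduct B ω := fun ω => by
        rw [ty, hB, c2_spinProduct_three hwd.1 hwd.2.1 hwd.2.2]
      rw [c2_res_lin P χ M hM hdet fy (spinProduct B) (spinProduct A) ιw β κy ty', ← mul_assoc]
      refine mul_nonneg (mul_nonneg_of_nonpos_of_nonpos hκx hκy) ?_
      -- the decimated system `ν` and `Law₂`
      have hKxy0 : ∀ i, 0 ≤ (if y ∈ C i then 0 else if x ∈ C i then 0 else K i) := fun i => by
        split_ifs <;> first | exact le_rfl | exact hK i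
      have hKxy' : ∀ i, x ∈ C i → (if y ∈ C i then 0 else if x ∈ C i then 0 else K i) = 0 :=
        fun i hi => by rw [if_pos hi, ite_self]
      obtain ⟨m', K', C', hK', hC', hX, hY, hdec⟩ := c2_nu K _ _ C hKxy0 hC x y hx hy
        cx cy Jx Jy hJx hJy v w hv hw hvd hwd hH1 hH2 (fun i hi => if_pos hi)
        (fun i hi => if_pos hi) hKxy' hx_x hx_y hy_y
        (fun ω => by rw [hhx]; exact (h3x (fun j => spinAt (v j) ω)
          (fun j => spinAt_eq_one_or_eq_neg_one _ _)).2)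
        (fun ω => by rw [hhy]; exact (h3y (fun j => spinAt (w j) ω)
          (fun j => spinAt_eq_one_or_eq_neg_one _ _)).2)
      have key := n6_law2_res_local hlaw K C K' C' hK' hC' x y hxy hX hY hdec S hS2 hS1 A B hA3 hB3
        hxA hyA hxB hyB
      rw [← hG, ← hMd] at key
      simpa only [hP, hχ] using key
    · obtain ⟨j₀, hj₀⟩ := c2_cube_degen w hwd
      have ty' : ∀ ω, fy ω = ∑ j, β j * χ (ιw j) ω + κy * χ (ιw j₀) ω := fun ω => by
        rw [ty, hj₀, hχ, hιw]
      rw [c2_res_degen P χ M hM hdet fy (spinProduct A) ιw β κy j₀ ty', mul_zero]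
  · obtain ⟨j₀, hj₀⟩ := c2_cube_degen v hvd
    have tx' : ∀ ω, fx ω = ∑ j, α j * χ (ιv j) ω + κx * χ (ιv j₀) ω := fun ω => by
      rw [tx, hj₀, hχ, hιv]
    rw [c2_res_degen P χ M hM hdet fx fy ιv α κx j₀ tx']

end Summit.CriticalPhenomena.Ising3DConformalLimit.Cruxes.InverseMFerromagnet.PartialCovarianceLadder
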